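import Literature.AlgebraicGeometry.Motives.ProjectiveSpaceFunctionField
import Literature.AlgebraicGeometry.Motives.CyclesPushforwardNormProofs
import Literature.AlgebraicGeometry.Motives.BaseChangeProofs
import Literature.AlgebraicGeometry.Motives.VarietiesProjectiveSpaceProofs
import Literature.AlgebraicGeometry.Motives.MorphismsToProjectiveSpace
import Mathlib.AlgebraicGeometry.ProjectiveSpectrum.Functor
import Mathlib.AlgebraicGeometry.Geometrically.Integral
import HarnessLib

/-!
# The projective line: involution, coordinate function, and maps `U → ℙ¹`

The pieces of `ℙ¹_k = Proj k[x₀, x₁]` needed for Fulton, *Intersection Theory*, Prop. 1.4 (a)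
(`f_*[div(r)] = 0` in relative dimension one), whose printed proof reduces to "Case 1:
`Y = Spec(K)`, `X = ℙ¹_K`" after mapping a curve to `ℙ¹` by a rational function; we replace the
explicit computation of Case 1 by the symmetry `t ↦ 1/t` of `ℙ¹`:

* `ProjLine.sw` — the graded involution of `k[x₀, x₁]` swapping the variables, and
  `ProjLine.σ = Proj.map sw : ℙ¹ → ℙ¹` (Mathlib `Proj.map`), an involution (`σ_σ`) over `k`
  (`σ_toSpec`, by Mathlib `Proj.awayι_comp_map` on the affine cover);
* `ProjLine.T s s'` — the rational function `s'/s` of two linear forms (germ at the generic point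
  of Mathlib's `Proj.awayToSection`), with `σ^♯(s'/s) = sw s'/sw s`
  (`functionFieldMap_σ_T`, by Mathlib `Proj.awayToSection_comp_appLE`) and the cocycle
  `(s'/s)(s/s') = 1` (`T_mul_T`, by Mathlib `Proj.awayMap_awayToSection`); hence for the coordinate
  `ProjLine.t = x₁/x₀`: `t ≠ 0` and **`σ^♯ t = t⁻¹`** (`functionFieldMap_σ_t`);
* `ProjLine.ρ u a : U → ℙ¹` — the `k`-morphism "`(1 : a)`" defined by a function `a ∈ Γ(U, 𝒪)` on
  a `k`-scheme `U`, through the chart `D₊(x₀) = Spec (k[x]_{(x₀)})₀ ≅ Spec k[T]` (`ProjLine.ψ`,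
  from `ProjectiveSpace.chartAlgEquiv`) and `x₁/x₀ ↦ a` (`ProjLine.φ`); it is dominant when `U` is
  affine integral and `a` is transcendental over `k` (`isDominant_ρ`), and **`ρ^♯ t = a`**
  (`functionFieldMap_ρ_t`; the key computation `res_awayι_awayToSection`: pulling the canonical
  section of `b` over `D₊(f)` back along the chart `Spec (A_{(f)})₀ → Proj A` returns `b`);
* `ProjLine.geometricallyIntegral_toSpec` — `ℙ¹_k → Spec k` is geometrically integral
  (geometrically irreducible by `Motives/VarietiesProjectiveSpaceProofs`, geometrically reduced
  chart by chart from Mathlib's `GeometricallyReduced (𝔸(n; S) ↘ S)`), so that `Y ×_k ℙ¹_k` is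
  integral for `Y` integral (Mathlib);
* `ProjLine.jT` — the chart `Spec k[T] ↪ ℙ¹` over `k`;
* `ProjLine.exists_projectiveLine` — all of the above packaged in one existential statement.

## References

* [Fulton1998] W. Fulton, *Intersection Theory*, 2nd ed. (1998), Prop. 1.4 (a), proof ("Case 1",
  "choose a finite morphism `g : X̃ → ℙ¹_K`").
* [Hartshorne1977] R. Hartshorne, *Algebraic Geometry* (1977), II Thm. 7.1 (morphisms to `ℙⁿ`),
  II Example 2.5.1 / Prop. 2.5 (b) (`D₊(f) = Spec A_{(f)}`).
-/

open CategoryTheory AlgebraicGeometry HomogeneousLocalization MvPolynomial Limits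
open Literature.AlgebraicGeometry.Motives

universe u

noncomputable section

attribute [local instance] MvPolynomial.gradedAlgebra MvPolynomial.algebraMvPolynomial
  Literature.AlgebraicGeometry.Motives.ProjBaseChange.algebraBase

namespace Literature.AlgebraicGeometry.Motives.ProjLine

variable (k : Type u) [Field k]

/-- grading [folklore] -/
abbrev A := Segre.grading (Fin 2) k

/-- The graded involution of `k[x₀, x₁]` swapping the variables. [folklore] -/
def sw : A k →+*ᵍ A k where
  __ := (rename (Equiv.swap (0 : Fin 2) 1) :
    MvPolynomial (Fin 2) k →ₐ[k] MvPolynomial (Fin 2) k).toRingHom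
  map_mem hx := by
    rw [mem_homogeneousSubmodule] at hx ⊢
    exact hx.rename_isHomogeneous

/-- Unfolding `sw`. [folklore] -/
theorem sw_apply (p : MvPolynomial (Fin 2) k) : sw k p = rename (Equiv.swap (0 : Fin 2) 1) p := rfl

/-- `sw x_i = x_{swap i}`. [folklore] -/
theorem sw_X (i : Fin 2) : sw k (X i) = X (Equiv.swap (0 : Fin 2) 1 i) := by
  rw [sw_apply, rename_X]

/-- `sw` is an involution. [folklore] -/
theorem sw_sw (p : MvPolynomial (Fin 2) k) : sw k (sw k p) = p := by
  rw [sw_apply, sw_apply, rename_rename]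
  have : (⇑(Equiv.swap (0 : Fin 2) 1) ∘ ⇑(Equiv.swap (0 : Fin 2) 1)) = id := by
    ext i; simp
  rw [this, rename_id_apply]

/-- The degree-zero projection of the grading is the degree-zero homogeneous component.
[folklore] -/
theorem proj_zero_eq (p : MvPolynomial (Fin 2) k) :
    GradedRing.proj (A k) 0 p = homogeneousComponent 0 p := by
  rw [GradedRing.proj_apply]
  exact MvPolynomial.decomposition.decompose'_apply p 0

/-- `sw` preserves the irrelevant ideal (it preserves constant coefficients). [folklore] -/
theorem sw_mem_irrelevant {p : MvPolynomial (Fin 2) k}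
    (hp : p ∈ HomogeneousIdeal.irrelevant (A k)) :
    sw k p ∈ HomogeneousIdeal.irrelevant (A k) := by
  rw [HomogeneousIdeal.mem_irrelevant_iff, proj_zero_eq, homogeneousComponent_zero] at hp ⊢
  rw [sw_apply, ← constantCoeff_eq, constantCoeff_rename, constantCoeff_eq, hp]

/-- The hypothesis of Mathlib's `Proj.map` for `sw`: the irrelevant ideal is generated by its
image. [folklore] -/
theorem irrelevant_le_map_sw :
    HomogeneousIdeal.irrelevant (A k) ≤ (HomogeneousIdeal.irrelevant (A k)).map (sw k) := by
  intro p hp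
  have : p = sw k (sw k p) := (sw_sw k p).symm
  rw [this]
  exact Ideal.mem_map_of_mem _ (sw_mem_irrelevant k hp)


/-- The projective line `ℙ¹_k = Proj k[x₀, x₁]` (= `ProjSpace.P 1 k`). [folklore] -/
abbrev P : Scheme.{u} := Proj (A k)

/-- The involution `σ : ℙ¹ → ℙ¹` swapping the homogeneous coordinates. [folklore] -/
def σ : P k ⟶ P k := Proj.map (sw k) (irrelevant_le_map_sw k)

/-- `Proj.map` of the identity is the identity (Mathlib `Proj.map_id`, with a propositional
equality of graded homomorphisms). [folklore] -/
theorem map_eq_id {f : A k →+*ᵍ A k} (hf) (h : f = GradedRingHom.id (A k)) :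
    Proj.map f hf = 𝟙 (P k) := by
  subst h; exact Proj.map_id

/-- `sw ∘ sw = id` as graded ring homomorphisms. [folklore] -/
theorem sw_comp_sw : (sw k).comp (sw k) = GradedRingHom.id (A k) := by
  ext p : 1
  exact sw_sw k p

/-- **`σ` is an involution**: `σ ∘ σ = 𝟙` (functoriality of `Proj`, Mathlib `Proj.map_comp`).
[folklore] -/
theorem σ_σ : σ k ≫ σ k = 𝟙 (P k) := by
  rw [σ, ← Proj.map_comp]
  exact map_eq_id k _ (sw_comp_sw k)


open TopologicalSpace

/-- The degree-zero fraction `s'/s ∈ (k[x]_{(s)})₀` of two linear forms. [folklore] -/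
def e (s s' : MvPolynomial (Fin 2) k) (hs : s ∈ A k 1) (hs' : s' ∈ A k 1) : Away (A k) s :=
  Away.mk (A k) hs 1 s' (by rwa [one_smul])

/-- The rational function `s'/s ∈ K(ℙ¹)`: the germ at the generic point of the section of `s'/s`
over `D₊(s)`. [folklore] -/
def T (s s' : MvPolynomial (Fin 2) k) (hs : s ∈ A k 1) (hs' : s' ∈ A k 1)
    (hη : genericPoint (P k) ∈ Proj.basicOpen (A k) s) : (P k).functionField :=
  (P k).presheaf.germ (Proj.basicOpen (A k) s) (genericPoint (P k)) hη
    (Proj.awayToSection (A k) s (e k s s' hs hs'))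

/-- `σ` is an isomorphism (its own inverse). [folklore] -/
instance : IsIso (σ k) := ⟨⟨σ k, σ_σ k, σ_σ k⟩⟩

/-- `σ^* (s'/s) = sw s' / sw s` on sections. [folklore] -/
theorem app_σ_awayToSection (s s' : MvPolynomial (Fin 2) k) (hs : s ∈ A k 1) (hs' : s' ∈ A k 1) :
    (σ k).app (Proj.basicOpen (A k) s) (Proj.awayToSection (A k) s (e k s s' hs hs')) =
      Proj.awayToSection (A k) (sw k s) (e k (sw k s) (sw k s') ((sw k).2 hs) ((sw k).2 hs')) := by
  have h := Proj.awayToSection_comp_appLE (sw k) (irrelevant_le_map_sw k) (s := s) hs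
  have h' := CategoryTheory.ConcreteCategory.congr_hom h (e k s s' hs hs')
  simp only [CategoryTheory.ConcreteCategory.comp_apply] at h'
  unfold σ
  rw [Scheme.Hom.app_eq_appLE]
  refine h'.trans ?_
  congr 1
  change Away.map (sw k) s (Away.mk (A k) hs 1 s' _) = Away.mk _ _ 1 _ _
  rw [Away.map_mk]

/-- `σ^♯ (s'/s) = sw s' / sw s` in `K(ℙ¹)`. [folklore] -/
theorem functionFieldMap_σ_T (s s' : MvPolynomial (Fin 2) k) (hs : s ∈ A k 1) (hs' : s' ∈ A k 1)
    (hη : genericPoint (P k) ∈ Proj.basicOpen (A k) s)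
    (hη' : genericPoint (P k) ∈ Proj.basicOpen (A k) (sw k s)) :
    RatFn.functionFieldMap (σ k) (T k s s' hs hs' hη) =
      T k (sw k s) (sw k s') ((sw k).2 hs) ((sw k).2 hs') hη' := by
  haveI : Nonempty (Proj.basicOpen (A k) s) := ⟨⟨_, hη⟩⟩
  haveI : Nonempty ((σ k) ⁻¹ᵁ Proj.basicOpen (A k) s) := ⟨⟨_, hη'⟩⟩
  have h := functionFieldMap_germToFunctionField (σ k) (Proj.basicOpen (A k) s)
    (Proj.awayToSection (A k) s (e k s s' hs hs')) (genericPoint (P k)) hη'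
  rw [app_σ_awayToSection] at h
  exact h

/-- The cocycle `(s'/s) · (s/s') = 1` in `K(ℙ¹)`. [folklore] -/
theorem T_mul_T (s s' : MvPolynomial (Fin 2) k) (hs : s ∈ A k 1) (hs' : s' ∈ A k 1)
    (hη : genericPoint (P k) ∈ Proj.basicOpen (A k) s)
    (hη' : genericPoint (P k) ∈ Proj.basicOpen (A k) s') :
    T k s s' hs hs' hη * T k s' s hs' hs hη' = 1 := by
  -- restrict both sections to `D₊(s s')`
  have hx₁ : s * s' = s * s' := rfl
  have hx₂ : s * s' = s' * s := mul_comm _ _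
  have hle₁ := Proj.basicOpen_mono (A k) _ _ ⟨_, hx₁⟩
  have hle₂ := Proj.basicOpen_mono (A k) _ _ ⟨_, hx₂⟩
  have hηx : genericPoint (P k) ∈ Proj.basicOpen (A k) (s * s') := by
    rw [Proj.basicOpen_mul]; exact ⟨hη, hη'⟩
  have r₁ := CategoryTheory.ConcreteCategory.congr_hom
    (Proj.awayMap_awayToSection (A k) (f := s) hs' hx₁) (e k s s' hs hs')
  have r₂ := CategoryTheory.ConcreteCategory.congr_hom
    (Proj.awayMap_awayToSection (A k) (f := s') hs hx₂) (e k s' s hs' hs)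
  simp only [CategoryTheory.ConcreteCategory.comp_apply, CommRingCat.hom_ofHom] at r₁ r₂
  have g₁ : T k s s' hs hs' hη = (P k).presheaf.germ (Proj.basicOpen (A k) (s * s'))
      (genericPoint (P k)) hηx (Proj.awayToSection (A k) (s * s')
        (awayMap (A k) hs' hx₁ (e k s s' hs hs'))) := by
    rw [r₁]
    unfold T
    rw [← TopCat.Presheaf.germ_res (P k).presheaf (homOfLE hle₁) _ hηx]
    rfl
  have g₂ : T k s' s hs' hs hη' = (P k).presheaf.germ (Proj.basicOpen (A k) (s * s'))
      (genericPoint (P k)) hηx (Proj.awayToSection (A k) (s * s')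
        (awayMap (A k) hs hx₂ (e k s' s hs' hs))) := by
    rw [r₂]
    unfold T
    rw [← TopCat.Presheaf.germ_res (P k).presheaf (homOfLE hle₂) _ hηx]
    rfl
  -- the identity `(s'·s')/(s s') · (s·s)/(s' s) = 1` in `(k[x]_{(s s')})₀`
  have hone :
      awayMap (A k) hs' hx₁ (e k s s' hs hs') * awayMap (A k) hs hx₂ (e k s' s hs' hs) = 1 := by
    apply HomogeneousLocalization.val_injective
    rw [HomogeneousLocalization.val_mul, HomogeneousLocalization.val_one, e, e, awayMap_mk,
      awayMap_mk, Away.val_mk, Away.val_mk, Localization.mk_mul]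
    rw [← Localization.mk_one, Localization.mk_eq_mk_iff, Localization.r_iff_exists]
    refine ⟨1, ?_⟩
    simp only [OneMemClass.coe_one, Submonoid.coe_mul, one_mul, mul_one]
    ring
  rw [g₁, g₂, ← map_mul, ← map_mul, hone, map_one, map_one]

/-- `T` only depends on the two linear forms. [folklore] -/
theorem T_congr {s₁ s₂ s₁' s₂' : MvPolynomial (Fin 2) k} (h : s₁ = s₂) (h' : s₁' = s₂')
    (hs₁ : s₁ ∈ A k 1) (hs₁' : s₁' ∈ A k 1) (hη₁ : genericPoint (P k) ∈ Proj.basicOpen (A k) s₁)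
    (hs₂ : s₂ ∈ A k 1) (hs₂' : s₂' ∈ A k 1) (hη₂ : genericPoint (P k) ∈ Proj.basicOpen (A k) s₂) :
    T k s₁ s₁' hs₁ hs₁' hη₁ = T k s₂ s₂' hs₂ hs₂' hη₂ := by
  subst h h'; rfl

/-- The generic point of `ℙ¹` lies in the standard charts. [folklore] -/
theorem genericPoint_mem_basicOpen_X (i : Fin 2) :
    genericPoint (P k) ∈ Proj.basicOpen (A k) (X i) :=
  ProjSpace.genericPoint_mem_U (d := 1) (K := k) i

/-- The coordinate `t = x₁/x₀ ∈ K(ℙ¹)`. [folklore] -/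
def t : (P k).functionField :=
  T k (X 0) (X 1) (Segre.X_mem k 0) (Segre.X_mem k 1) (genericPoint_mem_basicOpen_X k 0)

/-- `(x₁/x₀)(x₀/x₁) = 1`. [folklore] -/
theorem t_mul : t k * T k (X 1) (X 0) (Segre.X_mem k 1) (Segre.X_mem k 0)
    (genericPoint_mem_basicOpen_X k 1) = 1 :=
  T_mul_T k _ _ _ _ _ _

/-- `t ≠ 0`. [folklore] -/
theorem t_ne_zero : t k ≠ 0 := by
  intro h
  have := t_mul k
  rw [h, zero_mul] at this
  exact zero_ne_one this

/-- **`σ^♯ t = t⁻¹`.** [folklore] -/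
theorem functionFieldMap_σ_t : RatFn.functionFieldMap (σ k) (t k) = (t k)⁻¹ := by
  have hη' : genericPoint (P k) ∈ Proj.basicOpen (A k) (sw k (X 0)) := by
    rw [sw_X]; exact genericPoint_mem_basicOpen_X k _
  rw [t, functionFieldMap_σ_T k (X 0) (X 1) _ _ _ hη']
  refine (eq_inv_of_mul_eq_one_right ?_)
  rw [T_congr k (sw_X k 0) (sw_X k 1) _ _ hη' (Segre.X_mem k 1) (Segre.X_mem k 0)
    (genericPoint_mem_basicOpen_X k 1)]
  exact t_mul k

/-- `Away.map sw` is `k`-linear. [folklore] -/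
theorem awayMap_sw_comp_algebraMap (s : MvPolynomial (Fin 2) k) :
    (Away.map (sw k) s).comp (algebraMap k (Away (A k) s)) =
      algebraMap k (Away (A k) (sw k s)) := by
  ext c
  rw [RingHom.comp_apply, ProjBaseChange.algebraMap_eq', ProjBaseChange.algebraMap_eq', Away.map,
    HomogeneousLocalization.map_mk, HomogeneousLocalization.val_mk, HomogeneousLocalization.val_mk]
  dsimp only
  congr 1
  · change sw k (C c) = C c
    rw [sw_apply, rename_C]
  · exact Subtype.ext (map_one (sw k))

/-- **`σ` is a morphism over `k`.** [folklore] -/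
theorem map_sw_toSpec :
    Proj.map (sw k) (irrelevant_le_map_sw k) ≫ ProjBaseChange.projToSpec (Fin 2) k =
      ProjBaseChange.projToSpec (Fin 2) k := by
  refine (Proj.mapAffineOpenCover (sw k) (irrelevant_le_map_sw k)).openCover.hom_ext _ _ fun s ↦ ?_
  obtain ⟨⟨i, hi⟩, ⟨s, hs⟩⟩ := s
  simp only [Scheme.AffineOpenCover.openCover_f, Proj.mapAffineOpenCover_f]
  erw [Proj.awayι_comp_map_assoc (sw k) _ hi s hs]
  erw [ProjBaseChange.awayι_projToSpec (Fin 2) hs hi,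
    ProjBaseChange.awayι_projToSpec (Fin 2) ((sw k).2 hs) hi, ← Spec.map_comp,
    ← CommRingCat.ofHom_comp, awayMap_sw_comp_algebraMap]

/-- **`σ` is a morphism over `k`.** [folklore] -/
theorem σ_toSpec : σ k ≫ Segre.toSpec (Fin 2) k = Segre.toSpec (Fin 2) k := map_sw_toSpec k

/-! ### The chart `k[T] ≅ (k[x]_{(x₀)})₀`, `T ↦ x₁/x₀`, and morphisms to `ℙ¹` from a function -/

/-- `(k[x₀,x₁]_{(x₀)})₀ ≃ₐ[k] k[T]`, `x₁/x₀ ↦ T`. [folklore] -/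
def ψ : Away (A k) (X 0) ≃ₐ[k] Polynomial k :=
  (ProjectiveSpace.chartAlgEquiv k (n := 1) 0).trans (MvPolynomial.uniqueAlgEquiv k (Fin 1))

/-- `x₁/x₀` is the chart generator of `Motives/VarietiesProjectiveSpaceProofs`. [folklore] -/
theorem e_eq_chartGen : e k (X 0) (X 1) (Segre.X_mem k 0) (Segre.X_mem k 1) =
    ProjectiveSpace.chartGen k (n := 1) 0 0 := by
  apply HomogeneousLocalization.val_injective
  rw [e, Away.val_mk, ProjectiveSpace.val_chartGen]
  rfl

/-- `ψ (x₁/x₀) = T`. [folklore] -/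
theorem ψ_e : ψ k (e k (X 0) (X 1) (Segre.X_mem k 0) (Segre.X_mem k 1)) = Polynomial.X := by
  rw [e_eq_chartGen, ψ, AlgEquiv.trans_apply, ← ProjectiveSpace.chartAlgEquiv_symm_X,
    AlgEquiv.apply_symm_apply]
  simp [MvPolynomial.uniqueAlgEquiv]

variable {k} in
/-- The ring map `(k[x]_{(x₀)})₀ → Γ(U, 𝒪)`, `x₁/x₀ ↦ a`, for a `k`-scheme `U` and
`a ∈ Γ(U, 𝒪)`. [folklore] -/
def φ {U : Scheme.{u}} (u : U ⟶ Spec (.of k)) (a : Γ(U, ⊤)) : Away (A k) (X 0) →+* Γ(U, ⊤) :=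
  letI := (Segre.pull u).toAlgebra
  (Polynomial.aeval a).toRingHom.comp (ψ k).toRingHom

variable {k} in
/-- `φ (x₁/x₀) = a`. [folklore] -/
theorem φ_e {U : Scheme.{u}} (u : U ⟶ Spec (.of k)) (a : Γ(U, ⊤)) :
    φ u a (e k (X 0) (X 1) (Segre.X_mem k 0) (Segre.X_mem k 1)) = a := by
  letI := (Segre.pull u).toAlgebra
  simp [φ, ψ_e]

variable {k} in
/-- `φ` is `k`-linear. [folklore] -/
theorem φ_comp_cst {U : Scheme.{u}} (u : U ⟶ Spec (.of k)) (a : Γ(U, ⊤)) :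
    (φ u a).comp (Segre.cst k (X 0)) = Segre.pull u := by
  letI := (Segre.pull u).toAlgebra
  ext c
  change (Polynomial.aeval a) (ψ k (algebraMap k (Away (A k) (X 0)) c)) = algebraMap k Γ(U, ⊤) c
  rw [AlgEquiv.commutes, AlgHom.commutes]

variable {k} in
/-- The morphism `U → ℙ¹`, "`u ↦ (1 : a(u))`", through the chart `D₊(x₀)`. [folklore] -/
def ρ {U : Scheme.{u}} (u : U ⟶ Spec (.of k)) (a : Γ(U, ⊤)) : U ⟶ P k :=
  U.toSpecΓ ≫ Spec.map (CommRingCat.ofHom (φ u a)) ≫ Segre.chartι k 0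

variable {k} in
/-- `ρ` is a morphism over `k`. [folklore] -/
theorem ρ_toSpec {U : Scheme.{u}} (u : U ⟶ Spec (.of k)) (a : Γ(U, ⊤)) :
    ρ u a ≫ Segre.toSpec (Fin 2) k = u := by
  simp only [ρ, Category.assoc, Segre.chartι_toSpec]
  rw [← Spec.map_comp, ← CommRingCat.ofHom_comp, φ_comp_cst, Segre.toSpecΓ_SpecMap_pull]

/-! ### Pulling back the coordinate function along `ρ` -/

open GeneratingSections in
/-- Pulling back the canonical section of `b ∈ (A_{(f)})₀` over `D₊(f)` along the chart
`Spec (A_{(f)})₀ → Proj A` gives back `b`. [folklore] -/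
theorem res_awayι_awayToSection {σ' : Type u} {R : Type u} [CommRing R] [SetLike σ' R]
    [AddSubgroupClass σ' R] (𝒜 : ℕ → σ') [GradedRing 𝒜] (f : R) {m : ℕ} (hf : f ∈ 𝒜 m)
    (hm : 0 < m) (h : ⊤ ≤ Proj.awayι 𝒜 f hf hm ⁻¹ᵁ Proj.basicOpen 𝒜 f) (b : Away 𝒜 f) :
    res (Proj.awayι 𝒜 f hf hm) (Proj.basicOpen 𝒜 f) h (Proj.awayToSection 𝒜 f b) =
      (Scheme.ΓSpecIso (.of (Away 𝒜 f))).inv b := by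
  have key : (Proj.basicOpen 𝒜 f).ι.appLE (Proj.basicOpen 𝒜 f) ⊤
      (top_le_ι_preimage (Proj.basicOpen 𝒜 f)) = (Proj.basicOpen 𝒜 f).topIso.inv := by
    rw [Scheme.Opens.ι_appLE, Scheme.Opens.topIso_inv]
    exact congrArg (fun q ↦ (Proj 𝒜).presheaf.map (Quiver.Hom.op q)) (Subsingleton.elim _ _)
  have h1 : res (Proj.awayι 𝒜 f hf hm) (Proj.basicOpen 𝒜 f) h =
      ((Proj.basicOpenIsoSpec 𝒜 f hf hm).inv.appTop).hom.comp
        (res (Proj.basicOpen 𝒜 f).ι (Proj.basicOpen 𝒜 f)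
          (top_le_ι_preimage (Proj.basicOpen 𝒜 f))) :=
    res_comp _ _ _ _ _
  rw [h1, RingHom.comp_apply, res, key]
  have h2 : (Proj.basicOpen 𝒜 f).topIso.inv (Proj.awayToSection 𝒜 f b) =
      (Proj.basicOpenIsoSpec 𝒜 f hf hm).hom.appTop ((Scheme.ΓSpecIso (.of (Away 𝒜 f))).inv b) := by
    rw [Proj.basicOpenIsoSpec_hom, Scheme.Hom.appTop, Proj.basicOpenToSpec_app_top]
    simp only [CategoryTheory.ConcreteCategory.comp_apply]
    rw [CategoryTheory.Iso.inv_hom_id_apply]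
  change (Proj.basicOpenIsoSpec 𝒜 f hf hm).inv.appTop ((Proj.basicOpen 𝒜 f).topIso.inv _) = _
  rw [h2, ← CategoryTheory.ConcreteCategory.comp_apply, ← Scheme.Hom.comp_appTop, Iso.inv_hom_id,
    Scheme.Hom.id_appTop]
  rfl

open GeneratingSections in
variable {k} in
/-- Pulling back the section of `b ∈ (k[x]_{(x₀)})₀` over `D₊(x₀)` along `ρ` gives `φ b`.
[folklore] -/
theorem res_ρ_awayToSection {U : Scheme.{u}} (u : U ⟶ Spec (.of k)) (a : Γ(U, ⊤))
    (h : ⊤ ≤ ρ u a ⁻¹ᵁ Proj.basicOpen (A k) (X 0)) (b : Away (A k) (X 0)) :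
    res (ρ u a) (Proj.basicOpen (A k) (X 0)) h (Proj.awayToSection (A k) (X 0) b) = φ u a b := by
  have hj : ⊤ ≤ Segre.chartι k 0 ⁻¹ᵁ Proj.basicOpen (A k) (X (0 : Fin 2)) := by
    rw [← Proj.opensRange_awayι (A k) (X 0) (Segre.X_mem k 0) zero_lt_one]
    exact (Scheme.Hom.preimage_opensRange _).ge
  have h1 : (ρ u a).appLE (Proj.basicOpen (A k) (X 0)) ⊤ h =
      (Segre.chartι k 0).appLE (Proj.basicOpen (A k) (X 0)) ⊤ hj ≫
        (U.toSpecΓ ≫ Spec.map (CommRingCat.ofHom (φ u a))).appLE ⊤ ⊤ le_rfl := by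
    rw [Scheme.Hom.appLE_comp_appLE]; rfl
  have h2 := res_awayι_awayToSection (A k) (X 0) (Segre.X_mem k 0) zero_lt_one hj b
  rw [res] at h2 ⊢
  rw [h1, CategoryTheory.ConcreteCategory.comp_apply]
  erw [h2]
  rw [appLE_top_top]
  change Segre.pull (U.toSpecΓ ≫ Spec.map (CommRingCat.ofHom (φ u a))) b = _
  rw [Segre.pull_SpecMap, Segre.pull_apply, Scheme.toSpecΓ_appTop]
  simp

variable {k} in
/-- `ρ` lands in the chart `D₊(x₀)`. [folklore] -/
theorem preimage_ρ_basicOpen {U : Scheme.{u}} (u : U ⟶ Spec (.of k)) (a : Γ(U, ⊤)) :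
    ρ u a ⁻¹ᵁ Proj.basicOpen (A k) (X 0) = ⊤ := by
  unfold ρ
  rw [← Category.assoc, Scheme.Hom.comp_preimage,
    ← Proj.opensRange_awayι (A k) (X 0) (Segre.X_mem k 0) zero_lt_one,
    Scheme.Hom.preimage_opensRange]
  rfl

open GeneratingSections in
variable {k} in
/-- **`ρ^♯ t = a`**: the coordinate function pulls back to `a`. [folklore] -/
theorem functionFieldMap_ρ_t {U : Scheme.{u}} [IsIntegral U] (u : U ⟶ Spec (.of k)) (a : Γ(U, ⊤))
    [IsDominant (ρ u a)] :
    RatFn.functionFieldMap (ρ u a) (t k) = U.presheaf.germ ⊤ (genericPoint U) trivial a := by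
  haveI : Nonempty (Proj.basicOpen (A k) (X (0 : Fin 2))) := ⟨⟨_, genericPoint_mem_basicOpen_X k 0⟩⟩
  have hmem : (ρ u a).base (genericPoint U) ∈ Proj.basicOpen (A k) (X 0) := by
    change genericPoint U ∈ ρ u a ⁻¹ᵁ Proj.basicOpen (A k) (X 0)
    rw [preimage_ρ_basicOpen]; trivial
  haveI : Nonempty ((ρ u a) ⁻¹ᵁ Proj.basicOpen (A k) (X (0 : Fin 2))) := ⟨⟨_, hmem⟩⟩
  have h := functionFieldMap_germToFunctionField (ρ u a) (Proj.basicOpen (A k) (X 0))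
    (Proj.awayToSection (A k) (X 0) (e k (X 0) (X 1) (Segre.X_mem k 0) (Segre.X_mem k 1)))
    (genericPoint U) hmem
  change RatFn.functionFieldMap (ρ u a) (t k) = _ at h
  rw [h]
  have h' := res_ρ_awayToSection u a (by rw [preimage_ρ_basicOpen])
    (e k (X 0) (X 1) (Segre.X_mem k 0) (Segre.X_mem k 1))
  rw [φ_e, res] at h'
  have h2 : U.presheaf.germ ⊤ (genericPoint U) trivial ((ρ u a).appLE (Proj.basicOpen (A k) (X 0)) ⊤
      (by rw [preimage_ρ_basicOpen]) (Proj.awayToSection (A k) (X 0)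
        (e k (X 0) (X 1) (Segre.X_mem k 0) (Segre.X_mem k 1)))) =
      U.germToFunctionField ((ρ u a) ⁻¹ᵁ Proj.basicOpen (A k) (X 0))
        ((ρ u a).app (Proj.basicOpen (A k) (X 0)) (Proj.awayToSection (A k) (X 0)
          (e k (X 0) (X 1) (Segre.X_mem k 0) (Segre.X_mem k 1)))) := by
    rw [Scheme.Hom.appLE, CategoryTheory.ConcreteCategory.comp_apply,
      TopCat.Presheaf.germ_res_apply]
  rw [← h2]
  exact congrArg _ h'

/-! ### Dominance of `ρ` for a transcendental function -/

variable {k} in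
/-- `φ` is injective when `a` is transcendental over `k`. [folklore] -/
theorem φ_injective {U : Scheme.{u}} (u : U ⟶ Spec (.of k)) (a : Γ(U, ⊤))
    (ha : letI := (Segre.pull u).toAlgebra; Transcendental k a) : Function.Injective (φ u a) := by
  letI := (Segre.pull u).toAlgebra
  have h1 : Function.Injective (Polynomial.aeval (R := k) a) := transcendental_iff_injective.mp ha
  exact h1.comp (ψ k).injective

/-- `(k[x]_{(x₀)})₀ ≅ k[T]` is a domain. [folklore] -/
instance isDomain_away : IsDomain (Away (A k) (X (0 : Fin 2))) :=
  (ψ k).toMulEquiv.isDomain (Polynomial k)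

/-- An open immersion from a non-empty scheme into an irreducible scheme is dominant. [folklore] -/
theorem isDominant_of_isOpenImmersion {X Y : Scheme.{u}} (f : X ⟶ Y) [IsOpenImmersion f]
    [IrreducibleSpace X] [IrreducibleSpace Y] : IsDominant f := by
  refine ⟨?_⟩
  rw [denseRange_iff_closure_range]
  apply Set.eq_univ_of_univ_subset
  have h : closure {genericPoint Y} = Set.univ := genericPoint_spec Y
  rw [← h]
  apply closure_mono
  rw [Set.singleton_subset_iff, ← genericPoint_eq_of_isOpenImmersion f]
  exact Set.mem_range_self _

variable {k} in
/-- **`ρ` is dominant when `a` is transcendental over `k`** (`U` affine and integral). [folklore] -/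
theorem isDominant_ρ {U : Scheme.{u}} [IsIntegral U] [IsAffine U] (u : U ⟶ Spec (.of k))
    (a : Γ(U, ⊤)) (ha : letI := (Segre.pull u).toAlgebra; Transcendental k a) :
    IsDominant (ρ u a) := by
  haveI : IsDominant (Spec.map (CommRingCat.ofHom (φ u a))) := by
    refine ⟨?_⟩
    change DenseRange (PrimeSpectrum.comap (φ u a))
    rw [PrimeSpectrum.denseRange_comap_iff_ker_le_nilRadical,
      (RingHom.injective_iff_ker_eq_bot _).mp (φ_injective u a ha)]
    exact bot_le
  haveI : IsDominant (Segre.chartι k (ι := Fin 2) 0) := isDominant_of_isOpenImmersion _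
  unfold ρ
  infer_instance

/-! ### `ℙ¹_k → Spec k` is geometrically integral -/

/-- Affine space `Spec k[y₁,…,yₙ] → Spec k` is geometrically reduced (Mathlib's instance for
`𝔸(ι; S) ↘ S`, transported as in `ProjectiveSpace.geometricallyIrreducible_SpecMap_C`).
[cite: StacksProject, Tag 0366] -/
theorem geometricallyReduced_SpecMap_C (n : ℕ) :
    GeometricallyReduced (Spec.map (CommRingCat.ofHom (C : k →+* MvPolynomial (Fin n) k))) := by
  have h𝔸 : GeometricallyReduced
      (Spec.map (CommRingCat.ofHom (C : k →+* MvPolynomial (ULift.{u} (Fin n)) k))) := by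
    rw [← AffineSpace.SpecIso_inv_over (n := ULift.{u} (Fin n)) (.of k)]
    exact (MorphismProperty.cancel_left_of_respectsIso @GeometricallyReduced _ _).mpr inferInstance
  let ε : CommRingCat.of (MvPolynomial (ULift.{u} (Fin n)) k) ≅ .of (MvPolynomial (Fin n) k) :=
    (MvPolynomial.renameEquiv k Equiv.ulift).toRingEquiv.toCommRingCatIso
  have hC : CommRingCat.ofHom (C : k →+* MvPolynomial (Fin n) k) =
      CommRingCat.ofHom (C : k →+* MvPolynomial (ULift.{u} (Fin n)) k) ≫ ε.hom := by
    ext r : 2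
    exact (MvPolynomial.rename_C _ r).symm
  rw [hC, Spec.map_comp]
  exact (MorphismProperty.cancel_left_of_respectsIso @GeometricallyReduced _ _).mpr h𝔸

/-- The charts `Spec (k[x₀,x₁]_{(x_s)})₀ → Spec k` of `ℙ¹_k` are geometrically reduced.
[folklore] -/
theorem geometricallyReduced_chart (s : Fin 2) :
    GeometricallyReduced (Spec.map (CommRingCat.ofHom (algebraMap k (Away (A k) (X s))))) := by
  let ε : CommRingCat.of (MvPolynomial (Fin 1) k) ≅ .of (Away (A k) (X s)) :=
    (ProjectiveSpace.chartAlgEquiv k (n := 1) s).symm.toRingEquiv.toCommRingCatIso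
  have h : CommRingCat.ofHom (algebraMap k (Away (A k) (X s))) =
      CommRingCat.ofHom (C : k →+* MvPolynomial (Fin 1) k) ≫ ε.hom := by
    ext r : 2
    exact ((ProjectiveSpace.chartAlgEquiv k (n := 1) s).symm.commutes r).symm
  rw [h, Spec.map_comp]
  exact (MorphismProperty.cancel_left_of_respectsIso @GeometricallyReduced _ _).mpr
    (geometricallyReduced_SpecMap_C k 1)

/-- **`ℙ¹_k → Spec k` is geometrically reduced** (the charts are affine lines). [folklore] -/
theorem geometricallyReduced_toSpec : GeometricallyReduced (Segre.toSpec (Fin 2) k) := by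
  change GeometricallyReduced (ProjBaseChange.projToSpec (Fin 2) k)
  rw [geometricallyReduced_iff, geometrically_iff_of_commRing_of_isClosedUnderIsomorphisms]
  intro K _ _
  set f := ProjBaseChange.projToSpec (Fin 2) k
  set g := Spec.map (CommRingCat.ofHom (algebraMap k K))
  let 𝒱 := Scheme.Pullback.openCoverOfLeft (ProjectiveSpace.chartCover 1 k) f g
  haveI hX : ∀ s, IsReduced (𝒱.X s) := fun s ↦ by
    have : GeometricallyReduced ((ProjectiveSpace.chartCover 1 k).f s ≫ f) := by
      rw [ProjectiveSpace.chartCover_f_comp_projToSpec]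
      exact geometricallyReduced_chart k s
    change IsReduced (Limits.pullback ((ProjectiveSpace.chartCover 1 k).f s ≫ f) g)
    infer_instance
  exact @IsReduced.of_openCover _ 𝒱 hX

/-- **`ℙ¹_k → Spec k` is geometrically integral.** [folklore] -/
theorem geometricallyIntegral_toSpec : GeometricallyIntegral (Segre.toSpec (Fin 2) k) := by
  haveI := geometricallyReduced_toSpec k
  haveI : GeometricallyIrreducible (Segre.toSpec (Fin 2) k) :=
    (isSmoothProjective_projectiveSpace_holds k 1).geometricallyIrreducible
  exact GeometricallyIntegral.of_geometricallyReduced_of_geometricallyIrreducible _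

/-! ### The affine line `Spec k[T] ↪ ℙ¹` as the chart `D₊(x₀)` -/

/-- The open immersion `Spec k[T] ≅ D₊(x₀) ⊆ ℙ¹`, `T = x₁/x₀`. [folklore] -/
def jT : Spec (.of (Polynomial k)) ⟶ P k :=
  Spec.map (CommRingCat.ofHom (ψ k).toRingEquiv.toRingHom) ≫ Segre.chartι k 0

/-- `jT` is an open immersion. [folklore] -/
instance : IsOpenImmersion (jT k) := by
  haveI : IsIso (CommRingCat.ofHom (ψ k).toRingEquiv.toRingHom) :=
    (RingEquiv.toCommRingCatIso (ψ k).toRingEquiv).isIso_hom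
  unfold jT
  infer_instance

/-- `jT` is a morphism over `k`. [folklore] -/
theorem jT_toSpec : jT k ≫ Segre.toSpec (Fin 2) k =
    Spec.map (CommRingCat.ofHom (algebraMap k (Polynomial k))) := by
  unfold jT
  rw [Category.assoc, Segre.chartι_toSpec, ← Spec.map_comp, ← CommRingCat.ofHom_comp]
  congr 2
  ext c
  change ((ψ k) (algebraMap k (Away (A k) (X 0)) c)).coeff _ = _
  rw [AlgEquiv.commutes]

/-! ### The package -/

/-- `σ` is dominant. [folklore] -/
instance : IsDominant (σ k) := inferInstance

/-- **The projective line over a field, packaged**: a proper geometrically integral `k`-scheme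
`P = ℙ¹_k` with an involution `σ` over `k` (`(x₀ : x₁) ↦ (x₁ : x₀)`), a rational function
`t = x₁/x₀ ≠ 0` with `σ^♯ t = t⁻¹`, the affine chart `Spec k[T] ↪ P` over `k`, and, for every
affine integral `k`-scheme `U` and `a ∈ Γ(U, 𝒪)`, the `k`-morphism `ρ : U → P`, "`u ↦ (1 : a(u))`",
dominant when `a` is transcendental over `k`, with `ρ^♯ t = a`. [folklore] -/
theorem exists_projectiveLine :
    ∃ (P : Scheme.{u}) (toS : P ⟶ Spec (.of k)) (_ : IsIntegral P) (_ : IsProper toS)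
      (_ : GeometricallyIntegral toS) (_ : Flat toS) (_ : UniversallyOpen toS) (σ : P ⟶ P)
      (_ : IsIso σ) (_ : IsDominant σ) (t : P.functionField) (j : Spec (.of (Polynomial k)) ⟶ P)
      (_ : IsOpenImmersion j),
      σ ≫ σ = 𝟙 P ∧ σ ≫ toS = toS ∧ t ≠ 0 ∧ RatFn.functionFieldMap σ t = t⁻¹ ∧
      j ≫ toS = Spec.map (CommRingCat.ofHom (algebraMap k (Polynomial k))) ∧
      ∀ (U : Scheme.{u}) [IsIntegral U] [IsAffine U] (u : U ⟶ Spec (.of k)) (a : Γ(U, ⊤)),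
        ∃ ρ : U ⟶ P, ρ ≫ toS = u ∧
          ((letI := (Segre.pull u).toAlgebra; Transcendental k a) → IsDominant ρ) ∧
          ∀ [IsDominant ρ],
            RatFn.functionFieldMap ρ t = U.presheaf.germ ⊤ (genericPoint U) trivial a := by
  haveI : IsProper (Segre.toSpec (Fin 2) k) := ProjBaseChangeRing.isProper_projToSpec (Fin 2) k
  refine ⟨P k, Segre.toSpec (Fin 2) k, inferInstance, inferInstance, geometricallyIntegral_toSpec k,
    inferInstance, inferInstance, σ k, inferInstance, inferInstance, t k, jT k, inferInstance,
    σ_σ k, σ_toSpec k, t_ne_zero k, functionFieldMap_σ_t k, jT_toSpec k, ?_⟩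
  intro U _ _ u a
  exact ⟨ρ u a, ρ_toSpec u a, isDominant_ρ u a, functionFieldMap_ρ_t u a⟩

end Literature.AlgebraicGeometry.Motives.ProjLine
end
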